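import Literature.AlgebraicGeometry.Resolution.BlowupRingExceptionalFibre
import Literature.AlgebraicGeometry.Resolution.QuadraticTransformsStructure
import Literature.AlgebraicGeometry.Resolution.QuadraticTransformsChart
import Mathlib
import HarnessLib

/-!
# [OURS · L0 W4.1] K3-e: a quadratic transform WITHOUT DIMENSION DROP is residually FINITE
# (chain W4.1 `FrobeniusClosingSteer`, crux stmt-ResolutionOfSingularities-16345; K3 route (R1), RULING 250(a); `--supports … --as helper`)

HONEST FRAMING. OURS kernel (HIRONAKA-L librarian res-D-lib-1 gen 7). The input the K3 base change needs before anything else: along a quadratic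
transform `R ⊂ R₁ ⊆ K` of a regular local ring `R` with `dim R₁ = dim R`, the residue field extension `κ(R) → κ(R₁)` is FINITE (the centre on the
blow-up chart is a closed point). Route: `R₁ = R[𝔪/x]_𝔮` (`IsQuadraticTransform.eq_ofPrime`), the exceptional fibre `R[𝔪/x]/(x) ≅ κ(R)[T₁,…,T_{c-1}]`
(tree `blowupRing_chartQuotient_of_not_mem_sq`), heights (`ht 𝔮 = dim R₁ = c`, `ht 𝔮̄ ≥ c − 1 = dim κ[T]` ⇒ `𝔮̄` maximal) and Zariski's lemma
(Mathlib `finite_of_finite_type_of_isJacobsonRing`).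

* `isLocalHom_inclusion_of_subringDominates` — domination makes the inclusion a local homomorphism;
* `finite_residueField_of_comap_isMaximal` — if the centre `𝔮 = 𝔪_{R₁} ∩ R[𝔪/x]` is a MAXIMAL ideal of the chart ring then `κ(R₁)/κ(R)` is finite;
* `isMaximal_comap_of_ringKrullDim_eq` — `dim R₁ = dim R` forces the centre to be maximal;
* `finite_residueField_of_isQuadraticTransform` — the combination.

Nothing here is a statement of H. Hironaka's manuscript [Hironaka2017]. AI-written; AI review is weaker than expert review.
[cite: Cutkosky2014, §2.1] [cite: StacksProject, Tag 0BIQ]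
-/

set_option linter.dupNamespace false

noncomputable section

namespace Summit.ResolutionOfSingularities.ResolutionOfSingularities.Theorems.SwitchingDichotomy.EtaleLift

open IsLocalRing Literature.AlgebraicGeometry.Resolution

universe u

variable {K : Type u} [Field K]

/-! ## §1 Domination ⇒ local inclusion -/

/-- Domination `𝔪_{R₁} ∩ R = 𝔪_R` makes the inclusion `R → R₁` a local homomorphism. [cite: Cutkosky2014, §2.1] -/
theorem isLocalHom_inclusion_of_subringDominates {R R₁ : Subring K} (h : SubringDominates R R₁) :
    IsLocalHom (Subring.inclusion h.1) := by
  refine ⟨fun a ha => ?_⟩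
  rw [isUnit_subring_iff_inv_mem] at ha ⊢
  exact ⟨ha.1, h.2 _ a.2 ha.2⟩

/-! ## §2 Closed centre ⇒ finite residue extension -/

/-- **Closed centre ⇒ finite residue extension.** `R ⊆ K` regular local, `x ∈ 𝔪_R ∖ 𝔪_R²` non-zero, `B := R[𝔪/x] ⊆ R₁` with `R₁` local
dominating `R`, every element of `R₁` a fraction `a/b` (`a, b ∈ B`, `b⁻¹ ∈ R₁`); if the centre `𝔪_{R₁} ∩ B` is a MAXIMAL ideal of `B`, then
`κ(R₁)` is a finite `κ(R)`-module: `κ(R)[T_j] ≅ B/(x) ↠ κ(R₁)` is onto (the centre is closed), so `κ(R₁)` is a field of finite type over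
`κ(R)`, finite by Zariski's lemma. [cite: StacksProject, Tag 0BIQ] -/
theorem finite_residueField_of_comap_isMaximal {R R₁ : Subring K} [IsLocalRing R₁] (hreg : IsRegularLocalRing R)
    {x : R} (hxm : x ∈ maximalIdeal R) (hx2 : x ∉ maximalIdeal R ^ 2) (hx0 : x ≠ 0)
    (hT : blowupRing R (x : K) ≤ R₁) (hdom : SubringDominates R R₁)
    (hfrac : ∀ z ∈ R₁, ∃ a ∈ blowupRing R (x : K), ∃ b ∈ blowupRing R (x : K), b⁻¹ ∈ R₁ ∧ z = a / b)
    (hmax : ((maximalIdeal R₁).comap (Subring.inclusion hT)).IsMaximal) :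
    haveI := isLocalHom_inclusion_of_subringDominates hdom
    (ResidueField.map (Subring.inclusion hdom.1)).Finite := by
  classical
  haveI := hreg
  haveI hloc := isLocalHom_inclusion_of_subringDominates hdom
  set B := blowupRing R (x : K) with hB
  set 𝔮 : Ideal B := (maximalIdeal R₁).comap (Subring.inclusion hT) with h𝔮
  have hx0K : ((x : R) : K) ≠ 0 := fun e => hx0 (Subtype.ext e)
  -- `c := emb dim R > 0`
  set c := (maximalIdeal R).spanFinrank with hc
  have hc0 : 0 < c := by
    rw [hc, pos_iff_ne_zero]
    intro h0
    have hbot : maximalIdeal R = ⊥ := by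
      have hfg : (maximalIdeal R).FG := (isNoetherianRing_iff_ideal_fg R).mp inferInstance _
      rw [← Submodule.spanFinrank_eq_zero_iff_eq_bot hfg]
      exact h0
    exact hx0 ((Submodule.mem_bot R).mp (hbot ▸ hxm))
  -- the exceptional fibre `ψ : κ(R)[T_j] ≅ B/(x)`
  obtain ⟨ψ, hψ, hψC⟩ := blowupRing_chartQuotient_of_not_mem_sq R rfl (x : R).2 (by simpa using hxm) (by simpa using hx2) hx0K hc0
  let xB : B := ⟨(x : K), le_blowupRing R (x : K) x.2⟩
  have hle : R ≤ R₁ := hdom.1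
  -- `x ∈ 𝔪_{R₁}`
  have hxR₁ : Subring.inclusion hT xB ∈ maximalIdeal R₁ := by
    have : Subring.inclusion hT xB = Subring.inclusion hle x := Subtype.ext rfl
    rw [this]
    exact map_nonunit (Subring.inclusion hle) x hxm
  -- `χ : B/(x) → κ(R₁)`
  let χ : (B ⧸ Ideal.span {xB}) →+* ResidueField R₁ :=
    Ideal.Quotient.lift (Ideal.span {xB}) ((residue R₁).comp (Subring.inclusion hT)) (fun a ha => by
      obtain ⟨t, rfl⟩ := Ideal.mem_span_singleton'.mp ha
      rw [RingHom.comp_apply, map_mul, map_mul, (residue_eq_zero_iff _).mpr hxR₁, mul_zero])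
  -- `χ` is onto because the centre `𝔮` is maximal
  have hχ : Function.Surjective χ := by
    intro y
    obtain ⟨z, rfl⟩ := residue_surjective y
    obtain ⟨a, ha, b, hb, hbinv, hz⟩ := hfrac z z.2
    by_cases hb0 : b = 0
    · refine ⟨0, ?_⟩
      have : z = 0 := Subtype.ext (by rw [hz, hb0, div_zero]; rfl)
      rw [map_zero, this, map_zero]
    set aB : B := ⟨a, ha⟩
    set bB : B := ⟨b, hb⟩
    -- `b` is a unit of `R₁`, so `bB ∉ 𝔮`, so `bB` is invertible modulo the maximal ideal `𝔮`
    have hbunit : IsUnit (Subring.inclusion hT bB) := by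
      rw [isUnit_subring_iff_inv_mem]
      exact ⟨hb0, hbinv⟩
    have hbn : bB ∉ 𝔮 := fun h => (Ideal.mem_comap.mp h : Subring.inclusion hT bB ∈ maximalIdeal R₁) hbunit
    obtain ⟨b', hb'⟩ : ∃ b' : B, bB * b' - 1 ∈ 𝔮 := by
      have hne : Ideal.Quotient.mk 𝔮 bB ≠ 0 := by rwa [Ne, Ideal.Quotient.eq_zero_iff_mem]
      letI := Ideal.Quotient.field 𝔮
      obtain ⟨c', hc'⟩ := (isUnit_iff_ne_zero.mpr hne).exists_right_inv
      obtain ⟨b', rfl⟩ := Ideal.Quotient.mk_surjective c'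
      exact ⟨b', by rw [← Ideal.Quotient.eq_zero_iff_mem, map_sub, map_one, map_mul, hc', sub_self]⟩
    refine ⟨Ideal.Quotient.mk _ (aB * b'), ?_⟩
    rw [Ideal.Quotient.lift_mk, RingHom.comp_apply, map_mul, map_mul]
    -- `residue z * residue b = residue a` and `residue b * residue b' = 1`
    have hzb : z * Subring.inclusion hT bB = Subring.inclusion hT aB := by
      apply Subtype.ext
      change (z : K) * b = a
      rw [hz, div_mul_cancel₀ a hb0]
    have hbb' : residue R₁ (Subring.inclusion hT bB) * residue R₁ (Subring.inclusion hT b') = 1 := by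
      have hmem : Subring.inclusion hT (bB * b' - 1) ∈ maximalIdeal R₁ := Ideal.mem_comap.mp hb'
      rw [← map_mul, ← sub_eq_zero, ← map_one (residue R₁), ← map_sub, residue_eq_zero_iff, ← map_mul,
        ← map_one (Subring.inclusion hT), ← map_sub]
      exact hmem
    calc residue R₁ (Subring.inclusion hT aB) * residue R₁ (Subring.inclusion hT b')
        = residue R₁ z * (residue R₁ (Subring.inclusion hT bB) * residue R₁ (Subring.inclusion hT b')) := by
          rw [← hzb, map_mul, mul_assoc]
      _ = residue R₁ z := by rw [hbb', mul_one]
  -- `κ(R₁)` is of finite type over `κ(R)`: `κ(R)[T_j] ≅ B/(x) ↠ κ(R₁)`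
  letI : Algebra (ResidueField R) (ResidueField R₁) := (ResidueField.map (Subring.inclusion hle)).toAlgebra
  let g : MvPolynomial {j : Fin c // j ≠ ⟨0, hc0⟩} (ResidueField R) →ₐ[ResidueField R] ResidueField R₁ :=
    { χ.comp ψ with
      commutes' := fun r => by
        obtain ⟨s, rfl⟩ := residue_surjective r
        change χ (ψ (algebraMap _ _ (residue R s))) = ResidueField.map (Subring.inclusion hle) (residue R s)
        rw [MvPolynomial.algebraMap_eq, hψC, ResidueField.map_residue]
        change Ideal.Quotient.lift _ _ _ (Ideal.Quotient.mk _ _) = _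
        rw [Ideal.Quotient.lift_mk, RingHom.comp_apply]
        rfl }
  have hg : Function.Surjective g := hχ.comp hψ.2
  haveI : Algebra.FiniteType (ResidueField R) (ResidueField R₁) := Algebra.FiniteType.of_surjective g hg
  have hfin : Module.Finite (ResidueField R) (ResidueField R₁) :=
    finite_of_finite_type_of_isJacobsonRing (ResidueField R) (ResidueField R₁)
  exact hfin

/-! ## §3 The chart ring is Noetherian -/

/-- The chart ring `R[𝔪/x]` of a Noetherian local subring `R ⊆ K` is Noetherian (`𝔪` finitely generated, Hilbert). [folklore] -/
theorem isNoetherianRing_blowupRing (R : Subring K) [IsLocalRing R] [IsNoetherianRing R] (x : K) :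
    IsNoetherianRing (blowupRing R x) := by
  classical
  obtain ⟨u, hu⟩ := (isNoetherianRing_iff_ideal_fg R).mp inferInstance (maximalIdeal R)
  have hcl := blowupRing_eq_closure_of_span_eq (R := R) x (u : Set R) hu
  have hrange : Set.range (algebraMap R K) = (R : Set K) := by
    ext z; constructor
    · rintro ⟨r, rfl⟩; exact r.2
    · intro hz; exact ⟨⟨z, hz⟩, rfl⟩
  have hadj : (Algebra.adjoin R ((fun y : R => (y : K) / x) '' (u : Set R))).toSubring = blowupRing R x := by
    rw [Algebra.adjoin_eq_ring_closure, hrange, hcl]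
  have hfg : (Algebra.adjoin R ((fun y : R => (y : K) / x) '' (u : Set R))).FG := by
    rw [← Finset.coe_image]
    exact Subalgebra.fg_adjoin_finset _
  have hN : IsNoetherianRing (Algebra.adjoin R ((fun y : R => (y : K) / x) '' (u : Set R))).toSubring :=
    isNoetherianRing_of_fg hfg
  rw [hadj] at hN
  exact hN

/-! ## §4 No dimension drop ⇒ the centre is closed -/

/-- **No dimension drop ⇒ closed centre.** For a quadratic transform `R ⊂ R₁` of a regular local `R ⊆ K` with `dim R₁ = dim R = c` and a chart
`R[𝔪/x] ⊆ R₁` (`x ∈ 𝔪_R` non-zero), the centre `𝔪_{R₁} ∩ R[𝔪/x]` is a MAXIMAL ideal of the chart ring: `R₁ = R[𝔪/x]_𝔮` gives `ht 𝔮 = c`,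
the exceptional fibre `R[𝔪/x]/(x) ≅ κ(R)[T₁, …, T_{c-1}]` has dimension `c − 1 ≤ ht 𝔮̄`, so the image `𝔮̄` of `𝔮` is a prime of maximal height
in a Noetherian ring of finite dimension, hence maximal. [cite: StacksProject, Tag 0BIQ] -/
theorem isMaximal_comap_of_ringKrullDim_eq {R R₁ : Subring K} [IsLocalRing R] [IsLocalRing R₁] (h : IsQuadraticTransform R R₁)
    (hreg : IsRegularLocalRing R) [IsNoetherianRing R₁] {x : R} (hxm : x ∈ maximalIdeal R) (hx0 : x ≠ 0)
    (hT : blowupRing R (x : K) ≤ R₁) {c : ℕ} (hdim : ringKrullDim R = c) (hdim₁ : ringKrullDim R₁ = c) :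
    ((maximalIdeal R₁).comap (Subring.inclusion hT)).IsMaximal := by
  classical
  haveI := hreg
  have hdom := h.dominates
  have hle : R ≤ R₁ := hdom.1
  have hx2 : x ∉ maximalIdeal R ^ 2 := IsQuadraticTransform.chart_not_mem_sq hT hdom hx0
  have hx0K : ((x : R) : K) ≠ 0 := fun e => hx0 (Subtype.ext e)
  haveI hBN : IsNoetherianRing (blowupRing R (x : K)) := isNoetherianRing_blowupRing R (x : K)
  set 𝔮 : Ideal (blowupRing R (x : K)) := (maximalIdeal R₁).comap (Subring.inclusion hT) with h𝔮
  -- `spanFinrank 𝔪_R = c`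
  have hc : (maximalIdeal R).spanFinrank = c := by
    have h1 := hreg.spanFinrank_maximalIdeal
    rw [hdim] at h1
    exact_mod_cast h1
  have hc0 : 0 < c := by
    rw [← hc, pos_iff_ne_zero]
    intro h0
    have hfg : (maximalIdeal R).FG := (isNoetherianRing_iff_ideal_fg R).mp inferInstance _
    have hbot : maximalIdeal R = ⊥ := (Submodule.spanFinrank_eq_zero_iff_eq_bot hfg).mp h0
    exact hx0 ((Submodule.mem_bot R).mp (hbot ▸ hxm))
  -- `ht 𝔮 = c` : `R₁ = R[𝔪/x]_𝔮`
  have hq : (𝔮.height : WithBot ℕ∞) = c := by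
    have heq := h.eq_ofPrime hxm hx0 hT
    have e : R₁ ≃+* (LocalSubring.ofPrime (blowupRing R (x : K)) 𝔮).toSubring := RingEquiv.subringCongr heq
    rw [← IsLocalization.AtPrime.ringKrullDim_eq_height 𝔮 (LocalSubring.ofPrime (blowupRing R (x : K)) 𝔮).toSubring,
      ← ringKrullDim_eq_of_ringEquiv e, hdim₁]
  -- the exceptional fibre
  let xB : blowupRing R (x : K) := ⟨(x : K), le_blowupRing R (x : K) x.2⟩
  have hxq : xB ∈ 𝔮 := by
    rw [h𝔮, Ideal.mem_comap]
    have : Subring.inclusion hT xB = Subring.inclusion hle x := Subtype.ext rfl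
    rw [this]
    haveI := isLocalHom_inclusion_of_subringDominates hdom
    exact map_nonunit (Subring.inclusion hle) x hxm
  obtain ⟨ψ, hψ, -⟩ := blowupRing_chartQuotient_of_not_mem_sq R hc (x : R).2 (by simpa using hxm) (by simpa using hx2) hx0K hc0
  have hdimQ : ringKrullDim (blowupRing R (x : K) ⧸ Ideal.span {xB}) = (c - 1 : ℕ) := by
    rw [← ringKrullDim_eq_of_ringEquiv (RingEquiv.ofBijective ψ hψ), MvPolynomial.ringKrullDim_of_isNoetherianRing,
      ringKrullDim_eq_zero_of_field, zero_add, Nat.card_eq_fintype_card, Fintype.card_subtype_compl, Fintype.card_fin,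
      Fintype.card_subtype_eq]
  -- the image `𝔮̄` of `𝔮` in `R[𝔪/x]/(x)`
  set 𝔮b : Ideal (blowupRing R (x : K) ⧸ Ideal.span {xB}) := 𝔮.map (Ideal.Quotient.mk (Ideal.span {xB})) with h𝔮b
  have hker : RingHom.ker (Ideal.Quotient.mk (Ideal.span {xB})) ≤ 𝔮 := by
    rw [Ideal.mk_ker, Ideal.span_le, Set.singleton_subset_iff]
    exact hxq
  haveI h𝔮bp : 𝔮b.IsPrime := Ideal.map_isPrime_of_surjective Ideal.Quotient.mk_surjective hker
  have hqb_ge : (c : ℕ∞) ≤ 𝔮b.height + 1 := by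
    have h1 := Ideal.height_le_height_add_one_of_mem hxq
    have h2 : 𝔮.height = c := by exact_mod_cast hq
    rwa [h2] at h1
  have hqb_le : (𝔮b.height : WithBot ℕ∞) ≤ (c - 1 : ℕ) := hdimQ ▸ Ideal.height_le_ringKrullDim_of_isPrime
  have hqb : 𝔮b.height = (c - 1 : ℕ) := by
    have hle' : 𝔮b.height ≤ (c - 1 : ℕ) := by
      have h' := hqb_le
      rw [← WithBot.coe_natCast] at h'
      exact WithBot.coe_le_coe.mp h'
    refine le_antisymm hle' ?_
    have hne : 𝔮b.height ≠ ⊤ := ne_top_of_le_ne_top (by simp) hle'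
    obtain ⟨n, hn⟩ := ENat.ne_top_iff_exists.mp hne
    rw [← hn] at hqb_ge ⊢
    have : (c : ℕ∞) ≤ ((n + 1 : ℕ) : ℕ∞) := by simpa using hqb_ge
    have hcn : c ≤ n + 1 := by exact_mod_cast this
    exact_mod_cast (by omega : c - 1 ≤ n)
  -- a prime of maximal height is maximal
  have h𝔮bmax : 𝔮b.IsMaximal := by
    by_contra hnot
    obtain ⟨𝔫, h𝔫, hle𝔫⟩ := Ideal.exists_le_maximal 𝔮b h𝔮bp.ne_top
    have hne : 𝔮b ≠ 𝔫 := fun e => hnot (e ▸ h𝔫)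
    have hlt : 𝔮b < 𝔫 := lt_of_le_of_ne hle𝔫 hne
    have h1 := Ideal.height_strict_mono_of_isPrime hlt
    have h2 : (𝔫.height : WithBot ℕ∞) ≤ (c - 1 : ℕ) := hdimQ ▸ Ideal.height_le_ringKrullDim_of_isPrime
    have h2' : 𝔫.height ≤ (c - 1 : ℕ) := by
      have h' := h2
      rw [← WithBot.coe_natCast] at h'
      exact WithBot.coe_le_coe.mp h'
    rw [hqb] at h1
    exact lt_irrefl _ (lt_of_lt_of_le h1 h2')
  -- pull back to `R[𝔪/x]`
  have hcomap : 𝔮b.comap (Ideal.Quotient.mk (Ideal.span {xB})) = 𝔮 := by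
    rw [h𝔮b, Ideal.comap_map_of_surjective _ Ideal.Quotient.mk_surjective, sup_eq_left]
    rw [← RingHom.ker_eq_comap_bot]
    exact hker
  rw [← hcomap]
  exact Ideal.comap_isMaximal_of_surjective _ Ideal.Quotient.mk_surjective

/-! ## §5 Assembly -/

/-- **A quadratic transform of a regular local ring without dimension drop is residually finite**: for `R ⊂ R₁ ⊆ K` a quadratic transform with
`R` regular, `R₁` Noetherian local and `dim R₁ = dim R`, the residue field `κ(R₁)` is a finite extension of `κ(R)` (through the local inclusion).
[cite: Cutkosky2014, §2.1] [cite: StacksProject, Tag 0BIQ] -/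
theorem finite_residueField_of_isQuadraticTransform {R R₁ : Subring K} [IsLocalRing R] [IsLocalRing R₁]
    (h : IsQuadraticTransform R R₁) (hreg : IsRegularLocalRing R) [IsNoetherianRing R₁] {c : ℕ}
    (hdim : ringKrullDim R = c) (hdim₁ : ringKrullDim R₁ = c) :
    haveI := isLocalHom_inclusion_of_subringDominates h.dominates
    (ResidueField.map (Subring.inclusion h.dominates.1)).Finite := by
  obtain ⟨_, x, hxm, hx0, _, hT, hfrac, hdom⟩ := id h
  have hx2 : x ∉ maximalIdeal R ^ 2 := IsQuadraticTransform.chart_not_mem_sq hT hdom hx0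
  have hmax := isMaximal_comap_of_ringKrullDim_eq h hreg hxm hx0 hT hdim hdim₁
  exact finite_residueField_of_comap_isMaximal hreg hxm hx2 hx0 hT hdom hfrac hmax

/-! ## §6 (K3-a part 4, stage A): the residue tower of a window — a PRIMITIVE element of `κ(S₂)/κ(S₀)` and a MONIC LIFT of its minimal polynomial -/

section ResidueTower

open Polynomial

variable {R₀ R₁ R₂ : Subring K} [IsLocalRing R₀] [IsLocalRing R₁] [IsLocalRing R₂]

/-- The composite of two dominations is a domination whose local inclusion is the composite of the two local inclusions, on residue fields:
`κ(incl₀₂) = κ(incl₁₂) ∘ κ(incl₀₁)`. [folklore] -/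
theorem residueField_map_inclusion_trans (h₀₁ : SubringDominates R₀ R₁) (h₁₂ : SubringDominates R₁ R₂) :
    haveI := isLocalHom_inclusion_of_subringDominates h₀₁
    haveI := isLocalHom_inclusion_of_subringDominates h₁₂
    haveI := isLocalHom_inclusion_of_subringDominates (h₀₁.trans h₁₂)
    ResidueField.map (Subring.inclusion (h₀₁.trans h₁₂).1) =
      (ResidueField.map (Subring.inclusion h₁₂.1)).comp (ResidueField.map (Subring.inclusion h₀₁.1)) := by
  haveI := isLocalHom_inclusion_of_subringDominates h₀₁
  haveI := isLocalHom_inclusion_of_subringDominates h₁₂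
  haveI := isLocalHom_inclusion_of_subringDominates (h₀₁.trans h₁₂)
  rw [← ResidueField.map_comp]
  rfl

/-- **Stage A of the window packaging.** For two successive quadratic transforms `R₀ ⊂ R₁ ⊂ R₂ ⊆ K` of regular local rings without dimension drop and
with `κ(R₀)` perfect, the residue extension `κ(R₀) → κ(R₂)` is finite separable, so it has a PRIMITIVE element `θ̄`; its minimal polynomial lifts to a MONIC
`P ∈ R₀[X]` whose reduction is `minpoly κ(R₀) θ̄` (irreducible, separable), `P(θ̄) = 0` read through `κ(R₀) → κ(R₂)`, and every element of `κ(R₂)` is a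
polynomial in `θ̄` with coefficients from `κ(R₀)`. [folklore] -/
theorem exists_monic_lift_primitive (h₀₁ : IsQuadraticTransform R₀ R₁) (h₁₂ : IsQuadraticTransform R₁ R₂)
    (hreg₀ : IsRegularLocalRing R₀) (hreg₁ : IsRegularLocalRing R₁) [IsNoetherianRing R₂] {c : ℕ}
    (hdim₀ : ringKrullDim R₀ = c) (hdim₁ : ringKrullDim R₁ = c) (hdim₂ : ringKrullDim R₂ = c) [PerfectField (ResidueField R₀)] :
    haveI := isLocalHom_inclusion_of_subringDominates (h₀₁.dominates.trans h₁₂.dominates)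
    ∃ (P : R₀[X]) (θ : ResidueField R₂), P.Monic ∧ Irreducible (P.map (residue R₀)) ∧ (P.map (residue R₀)).Separable ∧
      P.eval₂ ((ResidueField.map (Subring.inclusion (h₀₁.dominates.trans h₁₂.dominates).1)).comp (residue R₀)) θ = 0 ∧
      ∀ y : ResidueField R₂, ∃ q : R₀[X],
        y = q.eval₂ ((ResidueField.map (Subring.inclusion (h₀₁.dominates.trans h₁₂.dominates).1)).comp (residue R₀)) θ := by
  haveI := hreg₀
  haveI := hreg₁
  have hd₀₁ := h₀₁.dominates
  have hd₁₂ := h₁₂.dominates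
  have hd₀₂ := hd₀₁.trans hd₁₂
  haveI := isLocalHom_inclusion_of_subringDominates hd₀₁
  haveI := isLocalHom_inclusion_of_subringDominates hd₁₂
  haveI := isLocalHom_inclusion_of_subringDominates hd₀₂
  -- the residue algebras `κ₀ → κ₁ → κ₂`
  letI alg₀₁ : Algebra (ResidueField R₀) (ResidueField R₁) := (ResidueField.map (Subring.inclusion hd₀₁.1)).toAlgebra
  letI alg₁₂ : Algebra (ResidueField R₁) (ResidueField R₂) := (ResidueField.map (Subring.inclusion hd₁₂.1)).toAlgebra
  letI alg₀₂ : Algebra (ResidueField R₀) (ResidueField R₂) := (ResidueField.map (Subring.inclusion hd₀₂.1)).toAlgebra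
  haveI : IsScalarTower (ResidueField R₀) (ResidueField R₁) (ResidueField R₂) :=
    IsScalarTower.of_algebraMap_eq fun r => by
      change ResidueField.map (Subring.inclusion hd₀₂.1) r =
        ResidueField.map (Subring.inclusion hd₁₂.1) (ResidueField.map (Subring.inclusion hd₀₁.1) r)
      rw [residueField_map_inclusion_trans hd₀₁ hd₁₂, RingHom.comp_apply]
  -- finiteness of the two steps (no dimension drop) and of the composite
  haveI : Module.Finite (ResidueField R₀) (ResidueField R₁) := finite_residueField_of_isQuadraticTransform h₀₁ hreg₀ hdim₀ hdim₁
  haveI : Module.Finite (ResidueField R₁) (ResidueField R₂) := finite_residueField_of_isQuadraticTransform h₁₂ hreg₁ hdim₁ hdim₂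
  haveI : Module.Finite (ResidueField R₀) (ResidueField R₂) := Module.Finite.trans (ResidueField R₁) (ResidueField R₂)
  haveI : Algebra.IsSeparable (ResidueField R₀) (ResidueField R₂) := inferInstance
  -- primitive element and its minimal polynomial
  obtain ⟨θ, hθ⟩ := Field.exists_primitive_element (ResidueField R₀) (ResidueField R₂)
  have hint : IsIntegral (ResidueField R₀) θ := Algebra.IsIntegral.isIntegral θ
  set m := minpoly (ResidueField R₀) θ with hm
  have hmon : m.Monic := minpoly.monic hint
  -- lift `m` to a monic `P ∈ R₀[X]`
  have hlifts : m ∈ Polynomial.lifts (residue R₀) := by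
    rw [Polynomial.mem_lifts]
    exact Polynomial.map_surjective (residue R₀) residue_surjective m
  obtain ⟨P, hPm, -, hPmon⟩ := Polynomial.lifts_and_degree_eq_and_monic hlifts hmon
  refine ⟨P, θ, hPmon, ?_, ?_, ?_, ?_⟩
  · rw [hPm]; exact minpoly.irreducible hint
  · rw [hPm]; exact Algebra.IsSeparable.isSeparable (ResidueField R₀) θ
  · rw [← Polynomial.eval₂_map, hPm]
    change Polynomial.aeval θ m = 0
    exact minpoly.aeval _ θ
  · intro y
    -- `κ₀⟮θ⟯ = ⊤` and `θ` is integral, so `κ₂ = κ₀[θ] = range (aeval θ)`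
    have hy : y ∈ (Algebra.adjoin (ResidueField R₀) {θ} : Subalgebra (ResidueField R₀) (ResidueField R₂)) := by
      rw [← IntermediateField.adjoin_simple_toSubalgebra_of_isAlgebraic (hint.isAlgebraic), hθ]
      trivial
    rw [Algebra.adjoin_singleton_eq_range_aeval] at hy
    obtain ⟨q, hq⟩ := hy
    obtain ⟨q₀, hq₀⟩ := Polynomial.map_surjective (residue R₀) residue_surjective q
    refine ⟨q₀, ?_⟩
    rw [← Polynomial.eval₂_map, hq₀, ← hq]
    rfl

end ResidueTower

end Summit.ResolutionOfSingularities.ResolutionOfSingularities.Theorems.SwitchingDichotomy.EtaleLift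

end
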